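import Summits.ResolutionOfSingularities.ResolutionOfSingularities.Theorems.WeightedInvariantLocalWeightedDropTrackCEnd
import Summits.ResolutionOfSingularities.ResolutionOfSingularities.Theorems.WeightedInvariantLocalWeightedDropTrackCMonomialDivisor

/-!
# Track C with the NORMAL-CROSSING payload: heredity and END (every divisor of the total transform is a unit-monomial)

[OURS · L1 W4.3 · chain w43, engine crux `LocalWeightedDrop` stmt-ResolutionOfSingularities-8899; res-type-088, piece (A3-β)
of strategist res-L1-w43-strat-1's line `tame-four-tuple-drop` (stub (A3) `stub_spaceNonNCCountRad_of_CJS`, cut 05:39Z/05:42Z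
with res-type-056)] NOT a statement of any manuscript.

The (A3) count is transferred from the Cossart–Jannsen–Saito sequence exactly as Track C transferred `Won`, but with the
payload «the germ is a NORMAL CROSSING»: in some formal coordinates `Φ` (no constant terms, invertible linear part)
`g∘Φ = v · ∏ Xᵢ^{eᵢ}` with `v(0) ≠ 0` — the body of the line's `SpaceIsNC`, written out EXPLICITLY here so that this file
needs no definition (the instance `SpaceIsNC g` is `⟨Φ, v, e, …⟩` verbatim).  This file supplies the two payload-specific
ingredients that do not depend on the tower induction:

* `exists_unit_mul_monomial_of_dvd_pow` — HEREDITY (the radical-monotonicity input (ii) of the count): if `b∘Φ` is a unit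
  times a monomial and `g ∣ b^(N+1)`, then `g∘Φ` is a unit times a monomial, for the SAME `Φ` (divisors of unit-monomials
  in the UFD `k⟦X⟧`, `TrackC.exists_eq_unit_mul_monomial_of_dvd`).
* `Frame.exists_nc_of_dvd_of_eq_unit_mul_monomial` — if in SOME Cohen frame an element of `𝒪̂_{Z,z}` reads as a unit times a
  monomial, every divisor of its reading in ANY frame is a normal crossing (frames differ by a legal coordinate change,
  `Frame.exists_subst`).
* `exists_nc_of_prime_dvd_rsop` — if every prime factor of `t ≠ 0` is associated to a member of a regular system of
  parameters, every divisor of `t` read in any frame is a normal crossing (`exists_eq_unit_mul_prod_pow_of_prime_dvd` +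
  adapted frames).
* `ncAt_end` — END: at the end `π : Z₁ ⟶ Z₀` of a CJS sequence of `V(b)` (`π⁻¹(V b) = X₁ ∪ B₁`, `X₁` closed and transversal
  to the snc divisor `B₁`, total transforms non-zero) EVERY divisor of the total transform of `b` read in ANY Cohen frame at
  ANY point is a normal crossing — the proof of `TrackC.wonAt_end` with the game replaced by the monomial conclusion.
-/

noncomputable section

open CategoryTheory AlgebraicGeometry TopologicalSpace IsLocalRing
open Literature.AlgebraicGeometry.Resolution
open Scheme.IdealSheafData

set_option linter.dupNamespace false -- mandated namespace of this single-conjunct summit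

namespace Summit.ResolutionOfSingularities.ResolutionOfSingularities.Theorems.TrackC

variable {k : Type} [Field k]

/-! ## Heredity: divisors of powers of normal crossings are normal crossings -/

/-- **HEREDITY.** If `b∘Φ = u · ∏ Xᵢ^{nᵢ}` with `u(0) ≠ 0` for a substitutable family `Φ`, and `g ∣ b^(N+1)`, then
`g∘Φ = v · ∏ Xᵢ^{eᵢ}` with `v(0) ≠ 0` for the same `Φ`. [OURS · folklore] -/
theorem exists_unit_mul_monomial_of_dvd_pow {m : ℕ} {b g : MvPowerSeries (Fin m) k}
    (Φ : Fin m → MvPowerSeries (Fin m) k) (hΦ0 : ∀ i, MvPowerSeries.constantCoeff (Φ i) = 0)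
    (u : MvPowerSeries (Fin m) k) (hu : MvPowerSeries.constantCoeff u ≠ 0) (n : Fin m → ℕ)
    (hb : MvPowerSeries.subst Φ b = u * ∏ i, MvPowerSeries.X i ^ n i) (N : ℕ) (hg : g ∣ b ^ (N + 1)) :
    ∃ (v : MvPowerSeries (Fin m) k) (e : Fin m → ℕ),
      MvPowerSeries.constantCoeff v ≠ 0 ∧ MvPowerSeries.subst Φ g = v * ∏ i, MvPowerSeries.X i ^ e i := by
  have hs : MvPowerSeries.HasSubst Φ := MvPowerSeries.hasSubst_of_constantCoeff_zero hΦ0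
  have hdvd : MvPowerSeries.subst Φ g ∣ u ^ (N + 1) * ∏ i, MvPowerSeries.X i ^ ((N + 1) * n i) := by
    have h1 := map_dvd (MvPowerSeries.substAlgHom (R := k) hs) hg
    simp only [MvPowerSeries.substAlgHom_apply, map_pow] at h1
    rw [hb, mul_pow, ← Finset.prod_pow] at h1
    simpa only [← pow_mul, mul_comm (n _) (N + 1)] using h1
  have hu' : MvPowerSeries.constantCoeff (u ^ (N + 1)) ≠ 0 := by
    rw [map_pow]
    exact pow_ne_zero _ hu
  exact exists_eq_unit_mul_monomial_of_dvd (u ^ (N + 1)) hu' _ _ hdvd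

/-! ## Frames: a monomial reading in one frame makes every divisor a normal crossing in every frame -/

namespace Frame

variable {Z : Scheme.{0}} {σ : Z ⟶ Spec (.of (MvPowerSeries (Fin 3) k))} {z : Z}
  [hN : IsNoetherianRing (Z.presheaf.stalk z)]

/-- **Normal crossings from a monomial frame.** If in SOME frame `F'` an element `T` of the completed local ring reads
as a unit times a monomial, then every divisor `g` of `T` read in ANY frame `F` is a normal crossing: for the legal
coordinate change `Φ` from `F` to `F'` (`Frame.exists_subst`), `g∘Φ = v · ∏ Xᵢ^{eᵢ}`, `v(0) ≠ 0`. [OURS · folklore] -/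
theorem exists_nc_of_dvd_of_eq_unit_mul_monomial (F F' : Frame σ z)
    (T : AdicCompletion (maximalIdeal (Z.presheaf.stalk z)) (Z.presheaf.stalk z))
    (u : MvPowerSeries (Fin 3) k) (hu : MvPowerSeries.constantCoeff u ≠ 0) (a : Fin 3 → ℕ)
    (hT : F'.e T = u * ∏ i, MvPowerSeries.X i ^ a i) (g : MvPowerSeries (Fin 3) k) (hg : g ∣ F.e T) :
    ∃ (Φ : Fin 3 → MvPowerSeries (Fin 3) k) (v : MvPowerSeries (Fin 3) k) (e : Fin 3 → ℕ),
      (∀ i, MvPowerSeries.constantCoeff (Φ i) = 0) ∧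
      IsUnit (Matrix.det (Matrix.of fun i j => MvPowerSeries.coeff (Finsupp.single j 1) (Φ i))) ∧
      MvPowerSeries.constantCoeff v ≠ 0 ∧ MvPowerSeries.subst Φ g = v * ∏ i, MvPowerSeries.X i ^ e i := by
  obtain ⟨φ, hφ0, hφdet, hφ⟩ := exists_subst F F'
  have hs : MvPowerSeries.HasSubst φ := MvPowerSeries.hasSubst_of_constantCoeff_zero hφ0
  have hdvd : MvPowerSeries.subst φ g ∣ u * ∏ i, MvPowerSeries.X i ^ a i := by
    rw [← hT, hφ]
    have := map_dvd (MvPowerSeries.substAlgHom (R := k) hs) hg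
    simpa only [MvPowerSeries.substAlgHom_apply] using this
  obtain ⟨v, e, hv, hge⟩ := exists_eq_unit_mul_monomial_of_dvd u hu a _ hdvd
  exact ⟨φ, v, e, hφ0, hφdet, hv, hge⟩

end Frame

/-! ## From prime factors to normal crossings -/

section Core

variable {Z : Scheme.{0}} {σ : Z ⟶ Spec (.of (MvPowerSeries (Fin 3) k))} {z : Z}
  [hN : IsNoetherianRing (Z.presheaf.stalk z)]

/-- **Core of the end.** At a framed point, if every prime factor of a non-zero element `t` of the local ring is
associated to a member of a regular system of parameters `y`, then every divisor of `t` read in any frame is a normal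
crossing: `t = u · ∏ yᵢ^{aᵢ}` is a unit times a monomial in the frame ADAPTED to `y`. [OURS · folklore] -/
theorem exists_nc_of_prime_dvd_rsop (F : Frame σ z) {d : ℕ} (y : Fin d → Z.presheaf.stalk z)
    (hspan : Ideal.span (Set.range y) = maximalIdeal (Z.presheaf.stalk z))
    (hdim : ringKrullDim (Z.presheaf.stalk z) = d) (t : Z.presheaf.stalk z) (ht : t ≠ 0)
    (hprime : ∀ q : Z.presheaf.stalk z, Prime q → q ∣ t → ∃ i, Associated q (y i))
    (g : MvPowerSeries (Fin 3) k) (hg : g ∣ F.e (algebraMap _ _ t)) :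
    ∃ (Φ : Fin 3 → MvPowerSeries (Fin 3) k) (v : MvPowerSeries (Fin 3) k) (e : Fin 3 → ℕ),
      (∀ i, MvPowerSeries.constantCoeff (Φ i) = 0) ∧
      IsUnit (Matrix.det (Matrix.of fun i j => MvPowerSeries.coeff (Finsupp.single j 1) (Φ i))) ∧
      MvPowerSeries.constantCoeff v ≠ 0 ∧ MvPowerSeries.subst Φ g = v * ∏ i, MvPowerSeries.X i ^ e i := by
  haveI := F.isRegularLocalRing
  have hd : d = 3 := by
    have h := hdim.symm.trans F.ringKrullDim_eq
    exact_mod_cast h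
  subst hd
  have hy : IsRsopPart y :=
    ⟨F.isRegularLocalRing, 0, Fin.elim0, by simpa using hdim, by simpa using hspan⟩
  obtain ⟨u, a, hu, hta⟩ := exists_eq_unit_mul_prod_pow_of_prime_dvd hy ht hprime
  obtain ⟨F', hF'⟩ := F.exists_adapted y hspan
  have hT : F'.e (algebraMap _ _ t) = F'.e (algebraMap _ _ u) * ∏ i, MvPowerSeries.X i ^ a i := by
    rw [hta, map_mul, map_mul, map_prod, map_prod]
    simp only [map_pow, hF']
  have hu' : MvPowerSeries.constantCoeff (F'.e (algebraMap _ _ u)) ≠ 0 := by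
    have h1 : IsUnit (F'.e (algebraMap _ _ u)) := (hu.map _).map _
    rw [MvPowerSeries.isUnit_iff_constantCoeff] at h1
    exact h1.ne_zero
  exact Frame.exists_nc_of_dvd_of_eq_unit_mul_monomial F F' _ _ hu' a hT g hg

end Core

/-! ## END with the normal-crossing payload -/

section End

variable (b : MvPowerSeries (Fin 3) k) {Z₁ : Scheme.{0}} (π : Z₁ ⟶ Spec (.of (MvPowerSeries (Fin 3) k)))
  (X₁ B₁ : Set Z₁)

/-- **END with the normal-crossing payload.** At the end `π : Z₁ ⟶ Z₀` of the Cossart–Jannsen–Saito sequence of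
`V(b) ⊆ Z₀` — `π⁻¹(V b) = X₁ ∪ B₁`, `X₁` closed and transversal to the strict normal crossings divisor `B₁`, total
transforms non-zero — EVERY divisor `g` of the total transform of `b` read in ANY Cohen frame at ANY point is a normal
crossing: `g∘Φ = v · ∏ Xᵢ^{eᵢ}`, `v(0) ≠ 0`, for a legal coordinate change `Φ`.  As in `TrackC.wonAt_end`: at `z ∈ X₁`
(resp. `z ∈ B₁ ∖ X₁`) the prime factors of `t = π♯ b` are among the transversal (resp. snc) parameters since
`√(t) = I(X₁)_z ∩ I(B₁)_z`; off `π⁻¹(V b)` the total transform is a unit. [OURS · folklore] -/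
theorem ncAt_end (hX₁c : IsClosed X₁) (hB₁ : IsStrictNormalCrossingsDivisor Z₁ B₁)
    (htot : π ⁻¹' ((Spec (.of (MvPowerSeries (Fin 3) k))).zeroLocus (U := ⊤)
      {(Scheme.ΓSpecIso (.of (MvPowerSeries (Fin 3) k))).inv.hom b} : Set _) = X₁ ∪ B₁)
    (htr : IsTransversalWith Z₁ X₁ B₁) (hT : ∀ z : Z₁, totalGerm π z b ≠ 0)
    (z : Z₁) (hN : IsNoetherianRing (Z₁.presheaf.stalk z)) (F : @Frame k _ Z₁ π z hN)
    (g : MvPowerSeries (Fin 3) k) (hg : g ∣ F.e (algebraMap _ _ (totalGerm π z b))) :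
    ∃ (Φ : Fin 3 → MvPowerSeries (Fin 3) k) (v : MvPowerSeries (Fin 3) k) (e : Fin 3 → ℕ),
      (∀ i, MvPowerSeries.constantCoeff (Φ i) = 0) ∧
      IsUnit (Matrix.det (Matrix.of fun i j => MvPowerSeries.coeff (Finsupp.single j 1) (Φ i))) ∧
      MvPowerSeries.constantCoeff v ≠ 0 ∧ MvPowerSeries.subst Φ g = v * ∏ i, MvPowerSeries.X i ^ e i := by
  haveI := F.isRegularLocalRing
  haveI := isDomain_of_isRegularLocalRing (Z₁.presheaf.stalk z)
  -- `√(t) = I(X₁)_z ∩ I(B₁)_z`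
  have hrad := radical_span_totalGerm π b z
  have hcl : (⟨π ⁻¹' ((Spec (.of (MvPowerSeries (Fin 3) k))).zeroLocus (U := ⊤)
      {(Scheme.ΓSpecIso (.of (MvPowerSeries (Fin 3) k))).inv.hom b}),
      (isClosed_zeroLocus b).preimage π.continuous⟩ : Closeds Z₁) = ⟨X₁, hX₁c⟩ ⊔ ⟨B₁, hB₁.1⟩ :=
    Closeds.ext (by simpa using htot)
  rw [hcl, vanishingIdeal_sup, stalkIdeal_inf] at hrad
  have hclX : (⟨closure X₁, isClosed_closure⟩ : Closeds Z₁) = ⟨X₁, hX₁c⟩ := Closeds.ext hX₁c.closure_eq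
  have hclB : (⟨closure B₁, isClosed_closure⟩ : Closeds Z₁) = ⟨B₁, hB₁.1⟩ := Closeds.ext hB₁.1.closure_eq
  -- prime factors of `t` see `X₁` or `B₁`
  have hq : ∀ q : Z₁.presheaf.stalk z, Prime q → q ∣ totalGerm π z b →
      stalkIdeal (vanishingIdeal ⟨X₁, hX₁c⟩) z ≤ Ideal.span {q} ∨
        stalkIdeal (vanishingIdeal ⟨B₁, hB₁.1⟩) z ≤ Ideal.span {q} := by
    intro q hq hdvd
    have hP : (Ideal.span {q}).IsPrime := (Ideal.span_singleton_prime hq.ne_zero).mpr hq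
    have h1 : (Ideal.span {totalGerm π z b}).radical ≤ Ideal.span {q} :=
      hP.radical_le_iff.mpr (Ideal.span_singleton_le_span_singleton.mpr hdvd)
    rw [hrad] at h1
    exact hP.inf_le.mp h1
  by_cases hzX : z ∈ X₁
  · -- transversal data at `z ∈ X₁`
    obtain ⟨-, r, e, zv, w, J, hdim, hspan, hIX, hIB⟩ := htr z hzX
    rw [hclX] at hIX
    rw [hclB] at hIB
    refine exists_nc_of_prime_dvd_rsop F (Fin.append zv w) (by rwa [range_fin_append]) hdim _ (hT z) ?_ g hg
    intro q hq' hdvd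
    rcases hq q hq' hdvd with h | h
    · -- `(zv) ⊆ (q)`: `r ≠ 0` (else `√(t) = 0`), and `q ∣ zv 0`
      rcases Nat.eq_zero_or_pos r with hr | hr
      · exfalso
        subst hr
        have h0 : Ideal.span (Set.range zv) = ⊥ := by
          rw [Set.range_eq_empty zv, Ideal.span_empty]
        rw [hIX, h0, bot_inf_eq] at hrad
        have : totalGerm π z b ∈ (Ideal.span {totalGerm π z b}).radical :=
          Ideal.le_radical (Ideal.mem_span_singleton_self _)
        rw [hrad] at this
        exact hT z ((Submodule.mem_bot _).mp this)
      · rw [hIX, Ideal.span_le] at h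
        have hmem : zv ⟨0, hr⟩ ∈ Ideal.span {q} := h ⟨⟨0, hr⟩, rfl⟩
        refine ⟨Fin.castAdd e ⟨0, hr⟩, ?_⟩
        rw [Fin.append_left]
        have hyz : IsRsopPart (Fin.append zv w) :=
          ⟨F.isRegularLocalRing, 0, Fin.elim0, by simpa using hdim, by simpa [range_fin_append] using hspan⟩
        have hp : Prime (zv ⟨0, hr⟩) := by
          have := hyz.prime (Fin.castAdd e ⟨0, hr⟩)
          rwa [Fin.append_left] at this
        exact hq'.irreducible.associated_of_dvd hp.irreducible (Ideal.mem_span_singleton.mp hmem)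
    · -- `(∏_{j ∈ J} w_j) ⊆ (q)`: `q ∣ w_j` for some `j`
      rw [hIB, Ideal.span_singleton_le_span_singleton] at h
      obtain ⟨j, -, hj⟩ := (hq'.dvd_finsetProd_iff _).mp h
      refine ⟨Fin.natAdd r j, ?_⟩
      rw [Fin.append_right]
      have hyz : IsRsopPart (Fin.append zv w) :=
        ⟨F.isRegularLocalRing, 0, Fin.elim0, by simpa using hdim, by simpa [range_fin_append] using hspan⟩
      have hp : Prime (w j) := by
        have := hyz.prime (Fin.natAdd r j)
        rwa [Fin.append_right] at this
      exact hq'.irreducible.associated_of_dvd hp.irreducible hj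
  · -- `I(X₁)_z = ⊤`
    have hIXtop : stalkIdeal (vanishingIdeal ⟨X₁, hX₁c⟩) z = ⊤ := by
      apply stalkIdeal_eq_top_of_not_mem_support
      rw [← SetLike.mem_coe, coe_support_vanishingIdeal]
      exact hzX
    by_cases hzB : z ∈ B₁
    · -- snc data at `z ∈ B₁ ∖ X₁`
      obtain ⟨-, r, e, x, y, -, hdim, hspan, hI⟩ := (hB₁.isStrictNormalCrossingsAt hzB)
      rw [hclB] at hI
      refine exists_nc_of_prime_dvd_rsop F (Fin.append x y) (by rwa [range_fin_append]) hdim _ (hT z) ?_ g hg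
      intro q hq' hdvd
      rcases hq q hq' hdvd with h | h
      · exfalso
        rw [hIXtop, top_le_iff, Ideal.span_singleton_eq_top] at h
        exact hq'.not_unit h
      · rw [hI, Ideal.span_singleton_le_span_singleton] at h
        obtain ⟨i, -, hi⟩ := (hq'.dvd_finsetProd_iff _).mp h
        refine ⟨Fin.castAdd e i, ?_⟩
        rw [Fin.append_left]
        have hyz : IsRsopPart (Fin.append x y) :=
          ⟨F.isRegularLocalRing, 0, Fin.elim0, by simpa using hdim, by simpa [range_fin_append] using hspan⟩
        have hp : Prime (x i) := by
          have := hyz.prime (Fin.castAdd e i)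
          rwa [Fin.append_left] at this
        exact hq'.irreducible.associated_of_dvd hp.irreducible hi
    · -- off `π⁻¹(V b)` the total transform is a unit: `g` divides a unit, frame `F` itself, identity change
      have hIBtop : stalkIdeal (vanishingIdeal ⟨B₁, hB₁.1⟩) z = ⊤ := by
        apply stalkIdeal_eq_top_of_not_mem_support
        rw [← SetLike.mem_coe, coe_support_vanishingIdeal]
        exact hzB
      rw [hIXtop, hIBtop, top_inf_eq, Ideal.radical_eq_top, Ideal.span_singleton_eq_top] at hrad
      have hunit : IsUnit (F.e (algebraMap _ _ (totalGerm π z b))) := (hrad.map _).map _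
      obtain ⟨uu, huu⟩ := hunit
      have hT' : F.e (algebraMap _ _ (totalGerm π z b)) =
          F.e (algebraMap _ _ (totalGerm π z b)) * ∏ i, MvPowerSeries.X i ^ (fun _ : Fin 3 => 0) i := by
        simp
      refine Frame.exists_nc_of_dvd_of_eq_unit_mul_monomial F F _ _ ?_ (fun _ => 0) hT' g hg
      rw [← huu]
      exact (MvPowerSeries.isUnit_iff_constantCoeff.mp uu.isUnit).ne_zero

end End

end Summit.ResolutionOfSingularities.ResolutionOfSingularities.Theorems.TrackC

end
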